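import Literature.NumberTheory.Sieve.GoldstonPintzYildirimThetaEulerBound
import HarnessLib

/-!
# Goldston–Pintz–Yıldırım, *Primes in tuples I*, §9: the bound (8.3) for the `φ`-weighted `G(s₁, s₂)`

Trunk: NumberTheory / Sieve. Continuation of `GoldstonPintzYildirimThetaEulerBound` (convergence
and holomorphy of `GStar = ∏_p starGFactor`, (9.17)–(9.19)): the hypothesis (8.3) of GPY's
Lemma 3 for the `G` of Proposition 2 — "`G(s₁,s₂) ≪_M exp(C M U^{δ₁+δ₂} log log U)`,
`U = CM² log(2h)`" (D. A. Goldston, J. Pintz, C. Y. Yıldırım, *Primes in tuples. I*, Ann. of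
Math. 170 (2009) = arXiv:math/0508185, §8 (8.3); "the analysis … is essentially unchanged", §9
after (9.23)). It is the twin, for the local data `ν*`, `ν̄*` and the denominators `(p−1)p^{s}`,
of `norm_G₂_le` ((7.12), `GoldstonPintzYildirimTwoVarG`), whose three prime sums
(`sum_small_le`, `sum_dvd_le_of_card_le`, `sum_large_le`) are reused. Everything here is PROVED
(theorems only).

* `nuStarPrime_le_card`, `nuBarStar_le_card`, `caseA_le_card`, `caseD_le_card` — `ν*_p(H₁⁰), a ≤ k₁`,
  `ν̄*_p, d ≤ k₁`;
* `norm_starFactor_le`, `norm_starGFactor_le_exp` — for every prime and `δ = δ₁ + δ₂ ≤ 1/4`, with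
  `X = p^{δ−1}`: `|starGFactor_p| ≤ e^{4k'X}`, `k' = 2(k₁+k₂)`;
* `norm_gStarLog_le_of_norms`, `norm_starGFactor_le_exp_sq` — for `p > U* = gpyU k* h`
  (`k* = 4(k₁+k₂)`), `p ∤ Δ(H⁰)`: `|starGFactor_p| ≤ e^{2k*²X²}` (the residual linear term
  `(1 − (1−1/p)⁻¹)(az₁ + bz₂ − dz₁₂) = O((a+b+d)X/p)` is absorbed in `X² ≥ X/p`);
* `prod_norm_starGFactor_le`, **`norm_GStar_le`** — for `−1/8 ≤ σ₁, σ₂`, `k₁ + k₂ ≥ 1`,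
  `H⁰ = H₁ ∪ H₂ ∪ {h₀} ⊆ [0, h]`:
  `|G(s₁,s₂)| ≤ exp(k* U*^{δ} (4 log log U* + 25))`, and `norm_GStar_le_of_re_nonneg` (`δ = 0`).

## References

* D. A. Goldston, J. Pintz, C. Y. Yıldırım, *Primes in tuples. I*, Ann. of Math. (2) 170 (2009),
  819–862 = arXiv:math/0508185, §8 (8.3), §9 after (9.19) and after (9.23); §6 (6.16), §7 (7.12).
  [cite: GoldstonPintzYildirim2009]
-/

noncomputable section

open Finset Filter
open scoped ArithmeticFunction.Moebius ArithmeticFunction.omega Topology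

namespace Literature.NumberTheory.Sieve.GPY

/-! ### Sizes of the local data -/

/-- `ν*_p(G⁰) ≤ #G` (`ν_p(G ∪ {h₀}) ≤ #G + 1`). [cite: GoldstonPintzYildirim2009, Section 9 eq. 9.9] -/
theorem nuStarPrime_le_card (h₀ : ℕ) (G : Finset ℕ) (p : ℕ) : nuStarPrime h₀ G p ≤ #G := by
  unfold nuStarPrime
  have h1 := nuPrime_le_card (insert h₀ G) p
  have h2 := Finset.card_insert_le h₀ G
  omega

/-- `ν̄*_p ≤ #H₁`. [cite: GoldstonPintzYildirim2009, Section 9 eq. 9.10] -/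
theorem nuBarStar_le_card (h₀ : ℕ) (H₁ H₂ : Finset ℕ) (p : ℕ) : nuBarStar h₀ H₁ H₂ p ≤ #H₁ := by
  unfold nuBarStar
  have h1 : nuBar (insert h₀ H₁) (insert h₀ H₂) p ≤ nuPrime (insert h₀ H₁) p := by
    rw [nuBar_eq_card_inter, nuPrime]
    exact Finset.card_le_card Finset.inter_subset_left
  have h2 := nuPrime_le_card (insert h₀ H₁) p
  have h3 := Finset.card_insert_le h₀ H₁
  omega

/-- `a ≤ k₁`. [cite: GoldstonPintzYildirim2009, Section 9 eq. 9.17] -/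
theorem caseA_le_card (h₀ : ℕ) (H₁ : Finset ℕ) : caseA h₀ H₁ ≤ #H₁ := Finset.card_erase_le

/-- `d ≤ k₁`. [cite: GoldstonPintzYildirim2009, Section 9 eq. 9.19] -/
theorem caseD_le_card (h₀ : ℕ) (H₁ H₂ : Finset ℕ) : caseD h₀ H₁ H₂ ≤ #H₁ :=
  (caseD_le_caseA h₀ H₁ H₂).trans (caseA_le_card h₀ H₁)

/-! ### Every prime: `|starGFactor_p| ≤ e^{4k'X}` -/

/-- `‖ν/((p−1)p^{s})‖ ≤ 2 ν X` when `‖p^{−(1+s)}‖ ≤ X` (`p ≥ 2`): the denominator `(p−1)p^{s}` of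
(9.16) is `(1 − 1/p) p^{1+s}` and `(1 − 1/p)⁻¹ ≤ 2`. [cite: GoldstonPintzYildirim2009, Section 9 eq. 9.16] -/
theorem norm_div_sub_one_mul_cpow_le {p : ℕ} (hp : 2 ≤ p) (ν : ℕ) {s : ℂ} {X : ℝ}
    (hx : ‖(p : ℂ) ^ (-(1 + s))‖ ≤ X) :
    ‖(ν : ℂ) / (((p : ℂ) - 1) * (p : ℂ) ^ s)‖ ≤ 2 * ν * X := by
  obtain ⟨hc, -⟩ := norm_inv_one_sub_inv_le hp
  have hX0 : 0 ≤ X := (norm_nonneg _).trans hx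
  rw [div_eq_mul_inv, inv_sub_one_mul_cpow hp, norm_mul, norm_mul, Complex.norm_natCast]
  calc (ν : ℝ) * (‖(1 - (p : ℂ)⁻¹)⁻¹‖ * ‖(p : ℂ) ^ (-(1 + s))‖) ≤ ν * (2 * X) :=
        mul_le_mul_of_nonneg_left (mul_le_mul hc hx (norm_nonneg _) (by norm_num)) (Nat.cast_nonneg ν)
    _ = 2 * ν * X := by ring

/-- For every prime `p` and `s₁, s₂` with `‖p^{−1−s₁}‖, ‖p^{−1−s₂}‖, ‖p^{−1−s₁−s₂}‖ ≤ X`: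
`|starFactor_p(s₁,s₂)| ≤ 1 + 2X(ν*₁ + ν*₂ + ν̄*) ≤ 1 + 4kX`, `k = k₁ + k₂`.
[cite: GoldstonPintzYildirim2009, Section 9 eq. 9.16] -/
theorem norm_starFactor_le (h₀ : ℕ) (H₁ H₂ : Finset ℕ) {p : ℕ} (hp : 2 ≤ p) {s₁ s₂ : ℂ} {X : ℝ}
    (hx : ‖(p : ℂ) ^ (-(1 + s₁))‖ ≤ X) (hy : ‖(p : ℂ) ^ (-(1 + s₂))‖ ≤ X)
    (hxy : ‖(p : ℂ) ^ (-(1 + s₁ + s₂))‖ ≤ X) :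
    ‖starFactor h₀ H₁ H₂ p s₁ s₂‖ ≤ 1 + 4 * ((#H₁ + #H₂ : ℕ) : ℝ) * X := by
  have hX0 : 0 ≤ X := (norm_nonneg _).trans hx
  have hxy' : ‖(p : ℂ) ^ (-(1 + (s₁ + s₂)))‖ ≤ X := by
    rwa [show (-(1 + (s₁ + s₂)) : ℂ) = -(1 + s₁ + s₂) by ring]
  have e1 := norm_div_sub_one_mul_cpow_le hp (nuStarPrime h₀ H₁ p) hx
  have e2 := norm_div_sub_one_mul_cpow_le hp (nuStarPrime h₀ H₂ p) hy
  have e3 := norm_div_sub_one_mul_cpow_le hp (nuBarStar h₀ H₁ H₂ p) hxy'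
  have b1 : (nuStarPrime h₀ H₁ p : ℝ) ≤ #H₁ := by exact_mod_cast nuStarPrime_le_card h₀ H₁ p
  have b2 : (nuStarPrime h₀ H₂ p : ℝ) ≤ #H₂ := by exact_mod_cast nuStarPrime_le_card h₀ H₂ p
  have b3 : (nuBarStar h₀ H₁ H₂ p : ℝ) ≤ #H₁ := by exact_mod_cast nuBarStar_le_card h₀ H₁ H₂ p
  unfold starFactor
  calc ‖1 - (nuStarPrime h₀ H₁ p : ℂ) / (((p : ℂ) - 1) * (p : ℂ) ^ s₁) -
        (nuStarPrime h₀ H₂ p : ℂ) / (((p : ℂ) - 1) * (p : ℂ) ^ s₂) +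
        (nuBarStar h₀ H₁ H₂ p : ℂ) / (((p : ℂ) - 1) * (p : ℂ) ^ (s₁ + s₂))‖
      ≤ ‖(1 : ℂ)‖ + ‖(nuStarPrime h₀ H₁ p : ℂ) / (((p : ℂ) - 1) * (p : ℂ) ^ s₁)‖ +
          ‖(nuStarPrime h₀ H₂ p : ℂ) / (((p : ℂ) - 1) * (p : ℂ) ^ s₂)‖ +
          ‖(nuBarStar h₀ H₁ H₂ p : ℂ) / (((p : ℂ) - 1) * (p : ℂ) ^ (s₁ + s₂))‖ := by
        refine (norm_add_le _ _).trans (add_le_add ((norm_sub_le _ _).trans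
          (add_le_add (norm_sub_le _ _) le_rfl)) le_rfl)
    _ ≤ 1 + 2 * nuStarPrime h₀ H₁ p * X + 2 * nuStarPrime h₀ H₂ p * X +
          2 * nuBarStar h₀ H₁ H₂ p * X := by rw [norm_one]; gcongr
    _ ≤ 1 + 2 * #H₁ * X + 2 * #H₂ * X + 2 * #H₁ * X := by gcongr
    _ ≤ 1 + 4 * ((#H₁ + #H₂ : ℕ) : ℝ) * X := by
        push_cast; nlinarith [mul_nonneg (Nat.cast_nonneg #H₂ : (0 : ℝ) ≤ #H₂) hX0]

/-- For every prime `p` and `δ = δ₁ + δ₂ ≤ 1/4`, with `X = p^{δ−1}` (`≤ 2^{−3/4} ≤ 2/3`):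
`|starGFactor_p| ≤ (1 + 4kX) e^{3aX} e^{3bX} (1+X)^d ≤ e^{8kX} = e^{4k'X}`, `k' = 2(k₁+k₂)` (case
exponents). [cite: GoldstonPintzYildirim2009, Section 8 eq. 8.3] -/
theorem norm_starGFactor_le_exp (h₀ : ℕ) (H₁ H₂ : Finset ℕ) {p : ℕ} (hp : p.Prime) {s₁ s₂ : ℂ}
    (hδ : max (-s₁.re) 0 + max (-s₂.re) 0 ≤ 1 / 4) :
    ‖starGFactor h₀ H₁ H₂ (caseA h₀ H₁) (caseA h₀ H₂) (caseD h₀ H₁ H₂) p s₁ s₂‖ ≤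
      Real.exp (4 * ((2 * (#H₁ + #H₂) : ℕ) : ℝ) *
        (p : ℝ) ^ (-(1 + -(max (-s₁.re) 0 + max (-s₂.re) 0)))) := by
  set δ : ℝ := max (-s₁.re) 0 + max (-s₂.re) 0 with hδdef
  set X : ℝ := (p : ℝ) ^ (-(1 + -δ)) with hXdef
  set k : ℕ := #H₁ + #H₂ with hkdef
  have hp0 := hp.pos
  have hp2 := hp.two_le
  obtain ⟨hx, hy, hz⟩ := norms_le_rpow_delta hp0 s₁ s₂
  rw [← hδdef] at hx hy hz
  have hX0 : 0 ≤ X := by positivity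
  have hX23 : X ≤ 2 / 3 := by
    calc X ≤ (p : ℝ) ^ (-(3 / 4 : ℝ)) :=
          Real.rpow_le_rpow_of_exponent_le (by exact_mod_cast hp.one_lt.le) (by linarith)
      _ ≤ (2 : ℝ) ^ (-(3 / 4 : ℝ)) :=
          Real.rpow_le_rpow_of_nonpos (by norm_num) (by exact_mod_cast hp.two_le) (by norm_num)
      _ ≤ 2 / 3 := two_rpow_neg_three_quarters_le
  have hksum : (k : ℝ) = #H₁ + #H₂ := by rw [hkdef]; push_cast; ring
  have hk₁ : (#H₁ : ℝ) ≤ k := by rw [hksum]; linarith [(Nat.cast_nonneg #H₂ : (0 : ℝ) ≤ #H₂)]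
  have ha : (caseA h₀ H₁ : ℝ) ≤ #H₁ := by exact_mod_cast caseA_le_card h₀ H₁
  have hb : (caseA h₀ H₂ : ℝ) ≤ #H₂ := by exact_mod_cast caseA_le_card h₀ H₂
  have hd : (caseD h₀ H₁ H₂ : ℝ) ≤ #H₁ := by exact_mod_cast caseD_le_card h₀ H₁ H₂
  -- first factor
  have h1 : ‖starFactor h₀ H₁ H₂ p s₁ s₂‖ ≤ Real.exp (4 * k * X) := by
    refine (norm_starFactor_le h₀ H₁ H₂ hp2 hx hy hz).trans ?_
    rw [← hkdef]
    linarith [Real.add_one_le_exp (4 * (k : ℝ) * X)]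
  -- `(1 - z)^d`
  have h2 : ‖(1 - (p : ℂ) ^ (-(1 + s₁ + s₂))) ^ caseD h₀ H₁ H₂‖ ≤ Real.exp (k * X) := by
    rw [norm_pow]
    have hb' : ‖1 - (p : ℂ) ^ (-(1 + s₁ + s₂))‖ ≤ 1 + X :=
      calc ‖1 - (p : ℂ) ^ (-(1 + s₁ + s₂))‖ ≤ ‖(1 : ℂ)‖ + ‖(p : ℂ) ^ (-(1 + s₁ + s₂))‖ := norm_sub_le _ _
        _ ≤ 1 + X := by rw [norm_one]; gcongr
    calc ‖1 - (p : ℂ) ^ (-(1 + s₁ + s₂))‖ ^ caseD h₀ H₁ H₂ ≤ (1 + X) ^ caseD h₀ H₁ H₂ :=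
          pow_le_pow_left₀ (norm_nonneg _) hb' _
      _ ≤ Real.exp X ^ caseD h₀ H₁ H₂ :=
          pow_le_pow_left₀ (by positivity) (by linarith [Real.add_one_le_exp X]) _
      _ = Real.exp (caseD h₀ H₁ H₂ * X) := by rw [← Real.exp_nat_mul]
      _ ≤ Real.exp (k * X) := Real.exp_le_exp.2 (mul_le_mul_of_nonneg_right (hd.trans hk₁) hX0)
  -- `(1 - zᵢ)^{-m}`
  have hinv : ∀ s : ℂ, ‖(p : ℂ) ^ (-(1 + s))‖ ≤ X → ∀ m : ℕ,
      ‖((1 - (p : ℂ) ^ (-(1 + s)))⁻¹) ^ m‖ ≤ Real.exp (3 * m * X) := by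
    intro s hs m
    rw [norm_pow, norm_inv]
    have hlow : 1 - X ≤ ‖1 - (p : ℂ) ^ (-(1 + s))‖ := by
      have := norm_sub_norm_le (1 : ℂ) ((p : ℂ) ^ (-(1 + s)))
      rw [norm_one] at this; linarith
    have h1x : 0 < 1 - X := by linarith
    have hi : ‖1 - (p : ℂ) ^ (-(1 + s))‖⁻¹ ≤ 1 + 3 * X := by
      refine (inv_anti₀ h1x hlow).trans ?_
      rw [inv_eq_one_div, div_le_iff₀ h1x]
      nlinarith
    calc ‖1 - (p : ℂ) ^ (-(1 + s))‖⁻¹ ^ m ≤ (1 + 3 * X) ^ m := pow_le_pow_left₀ (by positivity) hi _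
      _ ≤ Real.exp (3 * X) ^ m :=
          pow_le_pow_left₀ (by positivity) (by linarith [Real.add_one_le_exp (3 * X)]) _
      _ = Real.exp (m * (3 * X)) := by rw [← Real.exp_nat_mul]
      _ = Real.exp (3 * m * X) := by ring_nf
  have h3 : ‖((1 - (p : ℂ) ^ (-(1 + s₁)))⁻¹) ^ caseA h₀ H₁‖ ≤ Real.exp (3 * #H₁ * X) :=
    (hinv s₁ hx _).trans (Real.exp_le_exp.2 (by nlinarith))
  have h4 : ‖((1 - (p : ℂ) ^ (-(1 + s₂)))⁻¹) ^ caseA h₀ H₂‖ ≤ Real.exp (3 * #H₂ * X) :=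
    (hinv s₂ hy _).trans (Real.exp_le_exp.2 (by nlinarith))
  have hkk : ((2 * (#H₁ + #H₂) : ℕ) : ℝ) = 2 * k := by rw [hkdef]; push_cast; ring
  calc ‖starGFactor h₀ H₁ H₂ (caseA h₀ H₁) (caseA h₀ H₂) (caseD h₀ H₁ H₂) p s₁ s₂‖
      = ‖starFactor h₀ H₁ H₂ p s₁ s₂‖ * ‖((1 - (p : ℂ) ^ (-(1 + s₁)))⁻¹) ^ caseA h₀ H₁‖ *
          ‖((1 - (p : ℂ) ^ (-(1 + s₂)))⁻¹) ^ caseA h₀ H₂‖ *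
          ‖(1 - (p : ℂ) ^ (-(1 + s₁ + s₂))) ^ caseD h₀ H₁ H₂‖ := by
        rw [starGFactor, norm_mul, norm_mul, norm_mul]
    _ ≤ Real.exp (4 * k * X) * Real.exp (3 * #H₁ * X) * Real.exp (3 * #H₂ * X) * Real.exp (k * X) := by
        gcongr
    _ = Real.exp (8 * k * X) := by
        rw [← Real.exp_add, ← Real.exp_add, ← Real.exp_add, hksum]; ring_nf
    _ = Real.exp (4 * ((2 * (#H₁ + #H₂) : ℕ) : ℝ) * X) := by rw [hkk]; ring_nf

/-! ### Generic primes beyond `U*`: `|starGFactor_p| ≤ e^{2k*²X²}` -/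

/-- The logarithmic expansion with a free size parameter `X`: if `‖p^{−1−s₁}‖, ‖p^{−1−s₂}‖,
`‖p^{−1−s₁−s₂}‖ ≤ X ≤ 1/2` and `2(a+b+d)X ≤ 1/2` (`p ≥ 2`), then
`‖gStarLog‖ ≤ (2(a+b+d)X)² + (a+b+d)X² + (2/p)(a+b+d)X` (`norm_gStarLog_le` is the case
`X = p^{−3/4}`). [cite: GoldstonPintzYildirim2009, Section 9 eq. 9.17] -/
theorem norm_gStarLog_le_of_norms {a b d p : ℕ} (hp : 2 ≤ p) {s₁ s₂ : ℂ} {X : ℝ}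
    (hx : ‖(p : ℂ) ^ (-(1 + s₁))‖ ≤ X) (hy : ‖(p : ℂ) ^ (-(1 + s₂))‖ ≤ X)
    (hxy : ‖(p : ℂ) ^ (-(1 + s₁ + s₂))‖ ≤ X) (hX : X ≤ 1 / 2)
    (hmX : 2 * ((a : ℝ) + b + d) * X ≤ 1 / 2) :
    ‖gStarLog a b d p s₁ s₂‖ ≤
      (2 * ((a : ℝ) + b + d) * X) ^ 2 + ((a : ℝ) + b + d) * X ^ 2 + 2 / p * (((a : ℝ) + b + d) * X) := by
  have hp0 : 0 < p := by omega
  set m : ℝ := (a : ℝ) + b + d with hm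
  have hm0 : 0 ≤ m := by positivity
  have hX0 : 0 ≤ X := (norm_nonneg _).trans hx
  set z₁ := (p : ℂ) ^ (-(1 + s₁)) with hz₁def
  set z₂ := (p : ℂ) ^ (-(1 + s₂)) with hz₂def
  set z₁₂ := (p : ℂ) ^ (-(1 + s₁ + s₂)) with hz₁₂def
  set c := (1 - (p : ℂ)⁻¹)⁻¹ with hcdef
  set W := starW a b d p s₁ s₂ with hWdef
  obtain ⟨hc, hc1⟩ := norm_inv_one_sub_inv_le hp
  have hin' : ‖(a : ℂ) * z₁ + b * z₂ - d * z₁₂‖ ≤ a * X + b * X + d * X := by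
    refine (norm_sub_le _ _).trans (add_le_add ((norm_add_le _ _).trans (add_le_add ?_ ?_)) ?_)
    · rw [norm_mul, Complex.norm_natCast]; exact mul_le_mul_of_nonneg_left hx (Nat.cast_nonneg a)
    · rw [norm_mul, Complex.norm_natCast]; exact mul_le_mul_of_nonneg_left hy (Nat.cast_nonneg b)
    · rw [norm_mul, Complex.norm_natCast]; exact mul_le_mul_of_nonneg_left hxy (Nat.cast_nonneg d)
  have hin : ‖(a : ℂ) * z₁ + b * z₂ - d * z₁₂‖ ≤ m * X := by
    refine hin'.trans (le_of_eq ?_)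
    rw [hm]; ring
  have hW : ‖W‖ ≤ 2 * m * X := by
    rw [hWdef, starW, norm_mul]
    calc ‖(1 - (p : ℂ)⁻¹)⁻¹‖ * ‖(a : ℂ) * (p : ℂ) ^ (-(1 + s₁)) + b * (p : ℂ) ^ (-(1 + s₂)) -
          d * (p : ℂ) ^ (-(1 + s₁ + s₂))‖ ≤ 2 * (m * X) :=
          mul_le_mul hc hin (norm_nonneg _) (by norm_num)
      _ = 2 * m * X := by ring
  have hWhalf : ‖W‖ ≤ 1 / 2 := hW.trans hmX
  have hzhalf : ∀ {z : ℂ}, ‖z‖ ≤ X → ‖z‖ ≤ 1 / 2 := fun hz => hz.trans hX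
  have eW : ‖Complex.log (1 - W) + W‖ ≤ ‖W‖ ^ 2 := by
    rw [show Complex.log (1 - W) + W = -(-Complex.log (1 - W) - W) by ring, norm_neg]
    exact Literature.NumberTheory.LFunctions.norm_neg_log_one_sub_sub_le hWhalf
  have eZ : ∀ {z : ℂ}, ‖z‖ ≤ X → ‖Complex.log (1 - z) + z‖ ≤ X ^ 2 := fun {z} hz => by
    rw [show Complex.log (1 - z) + z = -(-Complex.log (1 - z) - z) by ring, norm_neg]
    exact (Literature.NumberTheory.LFunctions.norm_neg_log_one_sub_sub_le (hzhalf hz)).trans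
      (pow_le_pow_left₀ (norm_nonneg _) hz 2)
  have hlin : -W + a * z₁ + b * z₂ - d * z₁₂ = -((c - 1) * (a * z₁ + b * z₂ - d * z₁₂)) := by
    rw [hWdef, starW]
    ring
  have elin : ‖-W + a * z₁ + b * z₂ - d * z₁₂‖ ≤ 2 / p * (m * X) := by
    rw [hlin, norm_neg, norm_mul]
    exact mul_le_mul hc1 hin (norm_nonneg _) (by positivity)
  have hdec : gStarLog a b d p s₁ s₂ =
      (Complex.log (1 - W) + W) - a * (Complex.log (1 - z₁) + z₁) - b * (Complex.log (1 - z₂) + z₂) +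
        d * (Complex.log (1 - z₁₂) + z₁₂) + (-W + a * z₁ + b * z₂ - d * z₁₂) := by
    rw [gStarLog]; ring
  rw [hdec]
  have hna : ‖(a : ℂ) * (Complex.log (1 - z₁) + z₁)‖ ≤ a * X ^ 2 := by
    rw [norm_mul, Complex.norm_natCast]; exact mul_le_mul_of_nonneg_left (eZ hx) (Nat.cast_nonneg a)
  have hnb : ‖(b : ℂ) * (Complex.log (1 - z₂) + z₂)‖ ≤ b * X ^ 2 := by
    rw [norm_mul, Complex.norm_natCast]; exact mul_le_mul_of_nonneg_left (eZ hy) (Nat.cast_nonneg b)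
  have hnd : ‖(d : ℂ) * (Complex.log (1 - z₁₂) + z₁₂)‖ ≤ d * X ^ 2 := by
    rw [norm_mul, Complex.norm_natCast]; exact mul_le_mul_of_nonneg_left (eZ hxy) (Nat.cast_nonneg d)
  have hW2 : ‖W‖ ^ 2 ≤ (2 * m * X) ^ 2 := pow_le_pow_left₀ (norm_nonneg _) hW 2
  calc ‖(Complex.log (1 - W) + W) - a * (Complex.log (1 - z₁) + z₁) - b * (Complex.log (1 - z₂) + z₂) +
        d * (Complex.log (1 - z₁₂) + z₁₂) + (-W + a * z₁ + b * z₂ - d * z₁₂)‖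
      ≤ ‖W‖ ^ 2 + a * X ^ 2 + b * X ^ 2 + d * X ^ 2 + 2 / p * (m * X) := by
        refine (norm_add_le _ _).trans (add_le_add ?_ elin)
        refine (norm_add_le _ _).trans (add_le_add ?_ hnd)
        refine (norm_sub_le _ _).trans (add_le_add ?_ hnb)
        exact (norm_sub_le _ _).trans (add_le_add eW hna)
    _ ≤ (2 * m * X) ^ 2 + m * X ^ 2 + 2 / p * (m * X) := by
        have : (a : ℝ) * X ^ 2 + b * X ^ 2 + d * X ^ 2 = m * X ^ 2 := by rw [hm]; ring
        linarith

/-- For `p > U* = gpyU k* h` (`k* = 4(k₁+k₂)`, `k₁ + k₂ ≥ 1`), `p ∤ Δ(H⁰)` (`H⁰ = H₁ ∪ H₂ ∪ {h₀}`) and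
`−1/8 ≤ σ₁, σ₂`: `p` is generic, `k*X ≤ 1/2` (`X = p^{δ−1}`), the factor of `G` is `exp(gStarLog)`
with `‖gStarLog‖ ≤ 22k²X² ≤ 2k*²X²`, so `|starGFactor_p| ≤ exp(2k*²X²)`.
[cite: GoldstonPintzYildirim2009, Section 8 eq. 8.3] -/
theorem norm_starGFactor_le_exp_sq {h₀ : ℕ} {H₁ H₂ : Finset ℕ} (hk : 1 ≤ #H₁ + #H₂) {h p : ℕ}
    (hp : p.Prime) (hpU : gpyU (4 * (#H₁ + #H₂)) h < p)
    (hΔ : ¬ p ∣ discr (insert h₀ (H₁ ∪ H₂))) {s₁ s₂ : ℂ} (hs₁ : -1 / 8 ≤ s₁.re) (hs₂ : -1 / 8 ≤ s₂.re) :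
    ‖starGFactor h₀ H₁ H₂ (caseA h₀ H₁) (caseA h₀ H₂) (caseD h₀ H₁ H₂) p s₁ s₂‖ ≤
      Real.exp (2 * ((4 * (#H₁ + #H₂) : ℕ) : ℝ) ^ 2 *
        ((p : ℝ) ^ (-(1 + -(max (-s₁.re) 0 + max (-s₂.re) 0)))) ^ 2) := by
  set δ : ℝ := max (-s₁.re) 0 + max (-s₂.re) 0 with hδdef
  set X : ℝ := (p : ℝ) ^ (-(1 + -δ)) with hXdef
  set k : ℕ := #H₁ + #H₂ with hkdef
  set a := caseA h₀ H₁ with hadef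
  set b := caseA h₀ H₂ with hbdef
  set d := caseD h₀ H₁ H₂ with hddef
  have hp0 := hp.pos
  have hp2 := hp.two_le
  have hδ : δ ≤ 1 / 4 := by
    have h1 : max (-s₁.re) 0 ≤ 1 / 8 := max_le (by linarith) (by norm_num)
    have h2 : max (-s₂.re) 0 ≤ 1 / 8 := max_le (by linarith) (by norm_num)
    rw [hδdef]; linarith
  obtain ⟨hx, hy, hz⟩ := norms_le_rpow_delta hp0 s₁ s₂
  rw [← hδdef] at hx hy hz
  have hδ0 : 0 ≤ δ := add_nonneg (le_max_right _ _) (le_max_right _ _)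
  have hX0 : 0 ≤ X := by positivity
  -- `k* X ≤ 1/2`
  have hkX : ((4 * (#H₁ + #H₂) : ℕ) : ℝ) * X ≤ 1 / 2 :=
    card_mul_rpow_le_half (k := 4 * (#H₁ + #H₂)) hpU (σ := -δ) (by linarith)
  have hkk : ((4 * (#H₁ + #H₂) : ℕ) : ℝ) = 4 * (k : ℝ) := by rw [hkdef]; push_cast; ring
  have hk1 : (1 : ℝ) ≤ k := by exact_mod_cast hk
  have hksum : (k : ℝ) = #H₁ + #H₂ := by rw [hkdef]; push_cast; ring
  have hX4 : 4 * (k : ℝ) * X ≤ 1 / 2 := by rw [← hkk]; exact hkX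
  have hXhalf : X ≤ 1 / 2 := by nlinarith
  -- the size parameter `m = a + b + d ≤ 2k`
  have hm : (a : ℝ) + b + d ≤ 2 * k := by
    have h1 : (a : ℝ) ≤ #H₁ := by exact_mod_cast caseA_le_card h₀ H₁
    have h2 : (b : ℝ) ≤ #H₂ := by exact_mod_cast caseA_le_card h₀ H₂
    have h3 : (d : ℝ) ≤ #H₁ := by exact_mod_cast caseD_le_card h₀ H₁ H₂
    rw [hksum]; linarith [(Nat.cast_nonneg #H₂ : (0 : ℝ) ≤ #H₂)]
  have hm0 : 0 ≤ (a : ℝ) + b + d := by positivity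
  have hmX : 2 * ((a : ℝ) + b + d) * X ≤ 1 / 2 := by nlinarith
  -- genericity and the identification with `exp(gStarLog)`
  have hinj := injOn_mod_of_not_dvd_discr hΔ
  have hW : ‖starW a b d p s₁ s₂‖ ≤ 1 / 2 := by
    obtain ⟨hc, -⟩ := norm_inv_one_sub_inv_le hp2
    have hin : ‖(a : ℂ) * (p : ℂ) ^ (-(1 + s₁)) + b * (p : ℂ) ^ (-(1 + s₂)) -
        d * (p : ℂ) ^ (-(1 + s₁ + s₂))‖ ≤ a * X + b * X + d * X := by
      refine (norm_sub_le _ _).trans (add_le_add ((norm_add_le _ _).trans (add_le_add ?_ ?_)) ?_)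
      · rw [norm_mul, Complex.norm_natCast]; exact mul_le_mul_of_nonneg_left hx (Nat.cast_nonneg a)
      · rw [norm_mul, Complex.norm_natCast]; exact mul_le_mul_of_nonneg_left hy (Nat.cast_nonneg b)
      · rw [norm_mul, Complex.norm_natCast]; exact mul_le_mul_of_nonneg_left hz (Nat.cast_nonneg d)
    rw [starW, norm_mul]
    calc ‖(1 - (p : ℂ)⁻¹)⁻¹‖ * ‖(a : ℂ) * (p : ℂ) ^ (-(1 + s₁)) + b * (p : ℂ) ^ (-(1 + s₂)) -
          d * (p : ℂ) ^ (-(1 + s₁ + s₂))‖ ≤ 2 * (a * X + b * X + d * X) :=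
          mul_le_mul hc hin (norm_nonneg _) (by norm_num)
      _ = 2 * ((a : ℝ) + b + d) * X := by ring
      _ ≤ 1 / 2 := hmX
  have hG : starGFactor h₀ H₁ H₂ a b d p s₁ s₂ = Complex.exp (gStarLog a b d p s₁ s₂) := by
    rw [exp_gStarLog hp2 hs₁ hs₂ hW, starGFactor, starFactor_eq_generic hp2 hinj]
  rw [hG]
  refine (Complex.norm_exp_le_exp_norm _).trans (Real.exp_le_exp.2 ?_)
  refine (norm_gStarLog_le_of_norms hp2 hx hy hz hXhalf hmX).trans ?_
  -- `1/p ≤ X`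
  have hpX : 1 / (p : ℝ) ≤ X := by
    rw [hXdef, one_div, ← Real.rpow_neg_one]
    exact Real.rpow_le_rpow_of_exponent_le (by exact_mod_cast hp.one_lt.le) (by linarith)
  have e3 : 2 / (p : ℝ) * (((a : ℝ) + b + d) * X) ≤ 2 * ((a : ℝ) + b + d) * X ^ 2 := by
    have := mul_le_mul_of_nonneg_right hpX (mul_nonneg hm0 hX0)
    calc 2 / (p : ℝ) * (((a : ℝ) + b + d) * X) = 2 * (1 / (p : ℝ) * (((a : ℝ) + b + d) * X)) := by ring
      _ ≤ 2 * (X * (((a : ℝ) + b + d) * X)) := by linarith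
      _ = 2 * ((a : ℝ) + b + d) * X ^ 2 := by ring
  rw [hkk, ← hXdef]
  have hm2 : ((a : ℝ) + b + d) ^ 2 ≤ (2 * k) ^ 2 := pow_le_pow_left₀ hm0 hm 2
  have hm3 : ((a : ℝ) + b + d) ≤ 2 * (k : ℝ) ^ 2 := hm.trans (by nlinarith)
  calc (2 * ((a : ℝ) + b + d) * X) ^ 2 + ((a : ℝ) + b + d) * X ^ 2 + 2 / p * (((a : ℝ) + b + d) * X)
      ≤ (2 * ((a : ℝ) + b + d) * X) ^ 2 + ((a : ℝ) + b + d) * X ^ 2 + 2 * ((a : ℝ) + b + d) * X ^ 2 := by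
        linarith [e3]
    _ = (4 * ((a : ℝ) + b + d) ^ 2 + 3 * ((a : ℝ) + b + d)) * X ^ 2 := by ring
    _ ≤ (4 * (2 * (k : ℝ)) ^ 2 + 3 * (2 * (k : ℝ) ^ 2)) * X ^ 2 := by
        refine mul_le_mul_of_nonneg_right ?_ (sq_nonneg X)
        linarith
    _ ≤ 2 * (4 * (k : ℝ)) ^ 2 * X ^ 2 := by nlinarith [sq_nonneg X, sq_nonneg (k : ℝ)]

/-! ### Assembly: the bound for `G` -/

/-- Finite partial products: for every finite set `S` of primes, `−1/8 ≤ σ₁, σ₂` (`δ = δ₁ + δ₂`),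
`k₁ + k₂ ≥ 1`, `H⁰ ⊆ [0, h]`: `∏_{p ∈ S} |starGFactor_p| ≤ exp(k* U*^δ (4 log log U* + 25))`,
`k* = 4(k₁+k₂)`, `U* = gpyU k* h`. [cite: GoldstonPintzYildirim2009, Section 8 eq. 8.3] -/
theorem prod_norm_starGFactor_le {h₀ : ℕ} {H₁ H₂ : Finset ℕ} (hk : 1 ≤ #H₁ + #H₂) {h : ℕ}
    (hh : ∀ x ∈ insert h₀ (H₁ ∪ H₂), x ≤ h) {s₁ s₂ : ℂ} (hs₁ : -1 / 8 ≤ s₁.re)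
    (hs₂ : -1 / 8 ≤ s₂.re) (S : Finset Nat.Primes) :
    ∏ p ∈ S, ‖starGFactor h₀ H₁ H₂ (caseA h₀ H₁) (caseA h₀ H₂) (caseD h₀ H₁ H₂) p s₁ s₂‖ ≤
      Real.exp ((4 * (#H₁ + #H₂) : ℕ) * gpyU (4 * (#H₁ + #H₂)) h ^ (max (-s₁.re) 0 + max (-s₂.re) 0) *
        (4 * Real.log (Real.log (gpyU (4 * (#H₁ + #H₂)) h)) + 25)) := by
  set k' : ℕ := 4 * (#H₁ + #H₂) with hk'def
  set U := gpyU k' h with hUdef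
  set δ : ℝ := max (-s₁.re) 0 + max (-s₂.re) 0 with hδdef
  set σ : ℝ := -δ with hσdef
  have hU := gpyU_pos k' h
  have hδ0 : 0 ≤ δ := add_nonneg (le_max_right _ _) (le_max_right _ _)
  have hδ4 : δ ≤ 1 / 4 := by
    have h1 : max (-s₁.re) 0 ≤ 1 / 8 := max_le (by linarith) (by norm_num)
    have h2 : max (-s₂.re) 0 ≤ 1 / 8 := max_le (by linarith) (by norm_num)
    rw [hδdef]; linarith
  have hσ : -1 / 4 ≤ σ := by rw [hσdef]; linarith
  have hmax : max (-σ) 0 = δ := by rw [hσdef, neg_neg, max_eq_left hδ0]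
  have hcardH : #(insert h₀ (H₁ ∪ H₂)) ≤ k' := by
    rw [hk'def]
    have h1 := Finset.card_insert_le h₀ (H₁ ∪ H₂)
    have h2 := Finset.card_union_le H₁ H₂
    omega
  have hkk : ((2 * (#H₁ + #H₂) : ℕ) : ℝ) ≤ k' := by rw [hk'def]; push_cast; nlinarith
  -- the three majorants
  set A : Nat.Primes → ℝ := fun p => if ((p : ℕ) : ℝ) ≤ U then
    4 * (k' : ℝ) * (p : ℝ) ^ (-(1 + σ)) else 0 with hA
  set B : Nat.Primes → ℝ := fun p => if U < ((p : ℕ) : ℝ) ∧ (p : ℕ) ∣ discr (insert h₀ (H₁ ∪ H₂)) then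
    4 * (k' : ℝ) * (p : ℝ) ^ (-(1 + σ)) else 0 with hB
  set C : Nat.Primes → ℝ := fun p => if U < ((p : ℕ) : ℝ) then
    2 * (k' : ℝ) ^ 2 * ((p : ℝ) ^ (-(1 + σ))) ^ 2 else 0 with hC
  have hσδ : -(1 + σ) = -(1 + -δ) := by rw [hσdef]
  have hterm : ∀ p : Nat.Primes,
      ‖starGFactor h₀ H₁ H₂ (caseA h₀ H₁) (caseA h₀ H₂) (caseD h₀ H₁ H₂) p s₁ s₂‖ ≤
        Real.exp (A p + B p + C p) := by
    intro p
    have hX0 : 0 ≤ (p : ℝ) ^ (-(1 + σ)) := by positivity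
    have hgen : ‖starGFactor h₀ H₁ H₂ (caseA h₀ H₁) (caseA h₀ H₂) (caseD h₀ H₁ H₂) p s₁ s₂‖ ≤
        Real.exp (4 * (k' : ℝ) * (p : ℝ) ^ (-(1 + σ))) := by
      refine (norm_starGFactor_le_exp h₀ H₁ H₂ p.2 hδ4).trans (Real.exp_le_exp.2 ?_)
      rw [← hδdef, ← hσδ]
      exact mul_le_mul_of_nonneg_right (mul_le_mul_of_nonneg_left hkk (by norm_num)) hX0
    by_cases hpU : ((p : ℕ) : ℝ) ≤ U
    · have hA' : A p = 4 * (k' : ℝ) * (p : ℝ) ^ (-(1 + σ)) := if_pos hpU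
      have hB' : B p = 0 := if_neg (fun h' => not_lt.2 hpU h'.1)
      have hC' : C p = 0 := if_neg (not_lt.2 hpU)
      rw [hA', hB', hC', add_zero, add_zero]
      exact hgen
    · rw [not_le] at hpU
      have hA' : A p = 0 := if_neg (not_le.2 hpU)
      have hC' : C p = 2 * (k' : ℝ) ^ 2 * ((p : ℝ) ^ (-(1 + σ))) ^ 2 := if_pos hpU
      by_cases hpΔ : (p : ℕ) ∣ discr (insert h₀ (H₁ ∪ H₂))
      · have hB' : B p = 4 * (k' : ℝ) * (p : ℝ) ^ (-(1 + σ)) := if_pos ⟨hpU, hpΔ⟩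
        rw [hA', hB', hC', zero_add]
        refine hgen.trans (Real.exp_le_exp.2 ?_)
        have : 0 ≤ 2 * (k' : ℝ) ^ 2 * ((p : ℝ) ^ (-(1 + σ))) ^ 2 :=
          mul_nonneg (mul_nonneg zero_le_two (sq_nonneg _)) (sq_nonneg _)
        linarith
      · have hB' : B p = 0 := if_neg (fun h' => hpΔ h'.2)
        rw [hA', hB', hC', zero_add, zero_add, hσδ, hk'def]
        exact norm_starGFactor_le_exp_sq hk p.2 hpU hpΔ hs₁ hs₂
  have h1 : ∏ p ∈ S, ‖starGFactor h₀ H₁ H₂ (caseA h₀ H₁) (caseA h₀ H₂) (caseD h₀ H₁ H₂) p s₁ s₂‖ ≤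
      Real.exp (∑ p ∈ S, (A p + B p + C p)) := by
    rw [Real.exp_sum]
    exact Finset.prod_le_prod (fun p _ => norm_nonneg _) fun p _ => hterm p
  refine h1.trans (Real.exp_le_exp.2 ?_)
  rw [Finset.sum_add_distrib, Finset.sum_add_distrib]
  have hAs : ∑ p ∈ S, A p ≤ 4 * k' * U ^ δ * (Real.log (Real.log U) + 4) := by
    rw [hA, ← Finset.sum_filter, ← hmax]; exact sum_small_le k' h σ S
  have hBs : ∑ p ∈ S, B p ≤ 6 * k' * U ^ δ := by
    rw [hB, ← Finset.sum_filter, ← hmax]; exact sum_dvd_le_of_card_le hcardH hh hσ S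
  have hCs : ∑ p ∈ S, C p ≤ 3 * k' * U ^ δ := by
    rw [hC, ← Finset.sum_filter, ← hmax]; exact sum_large_le k' h hσ S
  have : 4 * k' * U ^ δ * (Real.log (Real.log U) + 4) + 6 * k' * U ^ δ + 3 * k' * U ^ δ =
      k' * U ^ δ * (4 * Real.log (Real.log U) + 25) := by ring
  linarith

/-- **The bound (8.3) for the `G` of Proposition 2** ("the analysis … is essentially unchanged",
§9): for `−1/8 ≤ σ₁, σ₂` (`δ = δ₁ + δ₂`, `δᵢ = max(−σᵢ, 0)`), `k₁ + k₂ ≥ 1`,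
`H₁ ∪ H₂ ∪ {h₀} ⊆ [0, h]`, `k* = 4(k₁+k₂)`, `U* = max(16, 4k*², k*² log 2h)`:
`|G(s₁,s₂)| ≤ exp(k* U*^{δ} (4 log log U* + 25))` — GPY's `G ≪ exp(CMU^{δ₁+δ₂} log log U)`.
[cite: GoldstonPintzYildirim2009, Section 8 eq. 8.3] -/
theorem norm_GStar_le {h₀ : ℕ} {H₁ H₂ : Finset ℕ} (hk : 1 ≤ #H₁ + #H₂) {h : ℕ}
    (hh : ∀ x ∈ insert h₀ (H₁ ∪ H₂), x ≤ h) {s₁ s₂ : ℂ} (hs₁ : -1 / 8 ≤ s₁.re)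
    (hs₂ : -1 / 8 ≤ s₂.re) :
    ‖GStar h₀ H₁ H₂ (caseA h₀ H₁) (caseA h₀ H₂) (caseD h₀ H₁ H₂) s₁ s₂‖ ≤
      Real.exp ((4 * (#H₁ + #H₂) : ℕ) * gpyU (4 * (#H₁ + #H₂)) h ^ (max (-s₁.re) 0 + max (-s₂.re) 0) *
        (4 * Real.log (Real.log (gpyU (4 * (#H₁ + #H₂)) h)) + 25)) := by
  have hprod := (multipliable_starGFactor (h₀ := h₀) (H₁ := H₁) (H₂ := H₂) hs₁ hs₂).hasProd
  have ht : Tendsto (fun S : Finset Nat.Primes =>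
      ‖∏ p ∈ S, starGFactor h₀ H₁ H₂ (caseA h₀ H₁) (caseA h₀ H₂) (caseD h₀ H₁ H₂) p s₁ s₂‖) atTop
      (𝓝 ‖GStar h₀ H₁ H₂ (caseA h₀ H₁) (caseA h₀ H₂) (caseD h₀ H₁ H₂) s₁ s₂‖) :=
    (continuous_norm.tendsto _).comp hprod
  refine le_of_tendsto' ht fun S => ?_
  rw [norm_prod]
  exact prod_norm_starGFactor_le hk hh hs₁ hs₂ S

/-- `|G(s₁,s₂)| ≤ exp(k*(4 log log U* + 25))` when `σ₁, σ₂ ≥ 0` (`δ = 0`).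
[cite: GoldstonPintzYildirim2009, Section 8 eq. 8.3] -/
theorem norm_GStar_le_of_re_nonneg {h₀ : ℕ} {H₁ H₂ : Finset ℕ} (hk : 1 ≤ #H₁ + #H₂) {h : ℕ}
    (hh : ∀ x ∈ insert h₀ (H₁ ∪ H₂), x ≤ h) {s₁ s₂ : ℂ} (hs₁ : 0 ≤ s₁.re) (hs₂ : 0 ≤ s₂.re) :
    ‖GStar h₀ H₁ H₂ (caseA h₀ H₁) (caseA h₀ H₂) (caseD h₀ H₁ H₂) s₁ s₂‖ ≤
      Real.exp ((4 * (#H₁ + #H₂) : ℕ) * (4 * Real.log (Real.log (gpyU (4 * (#H₁ + #H₂)) h)) + 25)) := by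
  have h := norm_GStar_le hk hh (s₁ := s₁) (s₂ := s₂) (by linarith) (by linarith)
  rwa [max_eq_right (by linarith : -s₁.re ≤ 0), max_eq_right (by linarith : -s₂.re ≤ 0), add_zero,
    Real.rpow_zero, mul_one] at h

end Literature.NumberTheory.Sieve.GPY
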